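import Literature.Computability.AlgebraicComplexity.LMR13BoundaryFormNotCone
import Literature.Computability.AlgebraicComplexity.LMR13StabilizerDimensions
import Literature.Algebra.Polynomial.JacobianCriterion
import HarnessLib

/-!
# LMR 2013 Prop. 3.5.1 at `n = 3`: the stabiliser count `dim 𝔤𝔩(W)_{P_{Λ,3}} = 17 = 2·3² − 1`

Landsberg–Manivel–Ressayre 2013, §3.5 (journal p. 481; arXiv:1004.4802 `p0008.txt:L80–94`): "the Lie
algebra of the stabilizer of `[P_Λ]` … has dimension `2n²`, which is one more than the dimension of the
stabilizer of `[det_n]`. This implies `\overline{GL(W)·P_Λ}` has codimension one in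
`\overline{GL(W)·det_n}`". In the tree's affine convention (the annihilator `glAnn P = 𝔤𝔩(W)_P` of
`GLAnnihilator.lean` does not contain the scalars) the printed count reads
`dim 𝔤𝔩(W)_{P_Λ} = 2n² − 1`; the lower bound `finrank_glAnn_pLambda_ge` is PROVED for all odd `n ≥ 3`
(`LMR13StabilizerDimensions.lean`), and `LMR2013_prop_3_5_1` follows from the upper bound
`finrank (glAnn (pLambda n)) ≤ finrank (glAnn det_n) + 1` alone
(`LMR2013_prop_3_5_1_of_finrank_glAnn_le`, `LMR13BoundaryMaximality.lean`).

This file PROVES the upper bound at `n = 3` (cell `val-lit`, item (X3b)-three of lead-lmr):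

* `finrank_glAnn_pLambda_three_le : finrank ℂ (glAnn (pLambda 3)) ≤ 17`, and with the lower bound
  `finrank_glAnn_pLambda_three : finrank ℂ (glAnn (pLambda 3)) = 17`.

Route (ours; the printed proof is a general representation-theoretic count). For `n = 3` the adjugate of
the skew part `A` of `M = A + S` is `u uᵀ` with the Pfaffian vector `u = (a₁₂, −a₀₂, a₀₁)` LINEAR in
`A`, so `P_{Λ,3}(M) = (1/3) tr(adj(A) S) = (1/3) uᵀ S u` becomes, after an invertible linear change of
variables `L` (`aeval_pLambda_three_uSu`, via the tree's `aeval_pLambda`), the cubic `Q = uᵀ S u` in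
the three `u`-variables `x_{ii}` and the six `S`-variables `x_{ij}`, `i ≠ j`. The orbit tangent space
`𝔤𝔩(W)·P = span {x_b ∂_a P}` (`glTangent`) can only shrink under `P ↦ P ∘ L`
(`finrank_glTangent_aeval_le`, chain rule `JacobianCriterion.pderiv_aeval`), and `𝔤𝔩(W)·Q` contains
`64 = 36 + 10 + 18` linearly independent cubics (`le_finrank_glTangent_uSu`): the monomials
`S_k u_i u_j = c · S_k ∂_{S_{ij}} Q` (block I), the cubic `u`-monomials `= c · u_i ∂_{S_{jk}} Q`
(block II), and the forms `S_k (S u)_l = ½ S_k ∂_{u_l} Q` (block III, independent because the generic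
symmetric matrix `𝕊` is non-singular: a relation `Σ_l ℓ_l (Su)_l = 0` forces `ℓ·𝕊 = 0`, so
`det 𝕊 · ℓ = 0`); the three blocks have `u`-weights `2, 3, 1`. Hence
`dim 𝔤𝔩(W)·P_{Λ,3} ≥ 64` and, by `finrank_glTangent_add_finrank_glAnn` (`81 = dim 𝔤𝔩·P + dim 𝔤𝔩_P`),
`dim 𝔤𝔩(W)_{P_{Λ,3}} ≤ 17`.

Theorem-only (no definitions, no named facts). Honest framing: an explicit finite-dimensional linear
algebra count for one 2013 example; **VP ≠ VNP is NOT proved and nothing here is progress on it.**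

## References

* [LandsbergManivelRessayre2013] J. M. Landsberg, L. Manivel, N. Ressayre, *Hypersurfaces with
  degenerate duals and the geometric complexity theory program*, Comment. Math. Helv. 88 (2013)
  469–484, §3.5, Prop. 3.5.1 (p. 481); arXiv:1004.4802.
* [HuttenhainLairez2016] J. Hüttenhain, P. Lairez, *The boundary of the orbit of the 3-by-3 determinant
  polynomial*, C. R. Math. Acad. Sci. Paris 354 (2016) 931–935 = arXiv:1512.02437, Thm. 1 (the two
  components of `∂Ω(det₃)`; cross-check of the `n = 3` case).
-/

noncomputable section

open MvPolynomial Matrix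

namespace Literature.Computability.AlgebraicComplexity

/-! ### Monotonicity of the orbit tangent space under a linear change of variables -/

section Monotone

variable {σ : Type*} [Fintype σ] [DecidableEq σ]

omit [Fintype σ] [DecidableEq σ] in
/-- The generators `x_b ∂_a P` lie in `𝔤𝔩(W)·P`. [folklore] -/
private theorem X_mul_pderiv_mem_glTangent (P : MvPolynomial σ ℂ) (a b : σ) :
    X b * pderiv a P ∈ glTangent P :=
  Submodule.subset_span ⟨a, b, rfl⟩

omit [Fintype σ] [DecidableEq σ] in
/-- A linear form times a partial derivative lies in `𝔤𝔩(W)·P`. [folklore] -/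
private theorem mul_pderiv_mem_glTangent_of_mem_span_X (P : MvPolynomial σ ℂ) {ℓ : MvPolynomial σ ℂ}
    (hℓ : ℓ ∈ Submodule.span ℂ (Set.range (X : σ → MvPolynomial σ ℂ))) (a : σ) :
    ℓ * pderiv a P ∈ glTangent P := by
  induction hℓ using Submodule.span_induction with
  | mem x hx =>
    obtain ⟨b, rfl⟩ := hx
    exact X_mul_pderiv_mem_glTangent P a b
  | zero => rw [zero_mul]; exact Submodule.zero_mem _
  | add x y _ _ hx hy => rw [add_mul]; exact Submodule.add_mem _ hx hy
  | smul c x _ hx => rw [smul_mul_assoc]; exact Submodule.smul_mem _ c hx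

/-- **`𝔤𝔩(W)·(P ∘ L) ⊆ L^*(𝔤𝔩(W)·P)`** for a linear change of variables `L` (substitution of linear
forms `L c` with constant partial derivatives, admitting linear forms `ℓ_b` with `ℓ_b ∘ L = x_b`): by
the chain rule `∂_a (P∘L) = Σ_c (∂_c P)∘L · ∂_a L_c`, every generator `x_b ∂_a (P∘L)` is the image
under `P ↦ P∘L` of an element of `𝔤𝔩(W)·P` (the equivariance of `𝔤𝔩(W)·P` behind the stabiliser
counts of LMR 2013 §3.5). [cite: LandsbergManivelRessayre2013, §3.5 (p. 481)] -/
theorem glTangent_aeval_le_map (L : σ → MvPolynomial σ ℂ)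
    (hL : ∀ c a, ∃ r : ℂ, pderiv a (L c) = C r)
    (hinv : ∀ b, ∃ ℓ : MvPolynomial σ ℂ,
      ℓ ∈ Submodule.span ℂ (Set.range (X : σ → MvPolynomial σ ℂ)) ∧ aeval L ℓ = X b)
    (P : MvPolynomial σ ℂ) :
    glTangent (aeval L P) ≤ (glTangent P).map (aeval L).toLinearMap := by
  rw [glTangent, Submodule.span_le]
  rintro _ ⟨a, b, rfl⟩
  rw [SetLike.mem_coe, Literature.Algebra.Polynomial.JacobianCriterion.pderiv_aeval, Finset.mul_sum]
  refine Submodule.sum_mem _ fun c _ => ?_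
  obtain ⟨r, hr⟩ := hL c a
  obtain ⟨ℓ, hℓ, hℓb⟩ := hinv b
  have h1 : X b * (aeval L (pderiv c P) * pderiv a (L c)) = r • aeval L (ℓ * pderiv c P) := by
    rw [hr, map_mul, hℓb, smul_eq_C_mul]
    ring
  rw [h1]
  exact Submodule.smul_mem _ _
    (Submodule.mem_map_of_mem (f := (aeval L).toLinearMap)
      (mul_pderiv_mem_glTangent_of_mem_span_X P hℓ c))

/-- Hence **`dim 𝔤𝔩(W)·(P∘L) ≤ dim 𝔤𝔩(W)·P`** for such a change of variables `L` (so the stabiliser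
count `dim 𝔤𝔩(W)_P = N² − dim 𝔤𝔩(W)·P` of LMR 2013 §3.5 can only grow).
[cite: LandsbergManivelRessayre2013, §3.5 (p. 481)] -/
theorem finrank_glTangent_aeval_le (L : σ → MvPolynomial σ ℂ)
    (hL : ∀ c a, ∃ r : ℂ, pderiv a (L c) = C r)
    (hinv : ∀ b, ∃ ℓ : MvPolynomial σ ℂ,
      ℓ ∈ Submodule.span ℂ (Set.range (X : σ → MvPolynomial σ ℂ)) ∧ aeval L ℓ = X b)
    (P : MvPolynomial σ ℂ) :
    Module.finrank ℂ (glTangent (aeval L P)) ≤ Module.finrank ℂ (glTangent P) := by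
  haveI := glTangent_finiteDimensional P
  exact (Submodule.finrank_mono (glTangent_aeval_le_map L hL hinv P)).trans
    (Submodule.finrank_map_le _ _)

omit [Fintype σ] [DecidableEq σ] in
/-- Rescaling by a nonzero constant does not change `𝔤𝔩(W)·P` (the counts of LMR 2013 §3.5 are
statements about the projective points `[P]`). [cite: LandsbergManivelRessayre2013, §3.5 (p. 481)] -/
theorem glTangent_C_mul {c : ℂ} (hc : c ≠ 0) (P : MvPolynomial σ ℂ) :
    glTangent (C c * P) = glTangent P := by
  have key : ∀ (c : ℂ) (P : MvPolynomial σ ℂ), glTangent (C c * P) ≤ glTangent P := by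
    intro c P
    rw [glTangent, Submodule.span_le]
    rintro _ ⟨a, b, rfl⟩
    rw [SetLike.mem_coe, (pderiv a).leibniz, pderiv_C, smul_zero, add_zero, smul_eq_mul,
      mul_left_comm, ← smul_eq_C_mul]
    exact Submodule.smul_mem _ _ (X_mul_pderiv_mem_glTangent P a b)
  refine le_antisymm (key c P) ?_
  have h := key c⁻¹ (C c * P)
  rwa [← mul_assoc, ← C_mul, inv_mul_cancel₀ hc, C_1, one_mul] at h

end Monotone

/-! ### `P_{Λ,3}` in adapted coordinates: `P_{Λ,3} ∘ L = (1/3) · uᵀ S u` -/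

section Three

/-- **`P_{Λ,3}` is a quadratic form in the Pfaffian vector.** For `n = 3` the adjugate of the skew part
`A` is `u uᵀ` with `u = (a₁₂, −a₀₂, a₀₁)` LINEAR in `A`, so after the linear change of variables
`M = A(u) + S` — `u_i ↦ x_{ii}`, the symmetric part `S` on the six off-diagonal variables
(`S_{00} ↦ x_{10}`, `S_{11} ↦ x_{21}`, `S_{22} ↦ x_{20}`, `S_{ij} ↦ x_{ij}` for `i < j`) —
`P_{Λ,3}(M) = (1/3) tr(adj(A) S) = (1/3) uᵀ S u`. (LMR 2013 §3.5, `P_Λ = det(A,…,A,S)`;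
the tree's `aeval_pLambda`.) [cite: LandsbergManivelRessayre2013, §3.5 (p. 480)] -/
theorem aeval_pLambda_three_uSu :
    aeval (fun p : Fin 3 × Fin 3 =>
      (!![X (1, 0), X (0, 1) + X (2, 2), X (0, 2) - X (1, 1);
          X (0, 1) - X (2, 2), X (2, 1), X (1, 2) + X (0, 0);
          X (0, 2) + X (1, 1), X (1, 2) - X (0, 0), X (2, 0)] :
        Matrix (Fin 3) (Fin 3) (MvPolynomial (Fin 3 × Fin 3) ℂ)) p.1 p.2) (pLambda 3) =
      C (1 / 3 : ℂ) * (X (1, 0) * X (0, 0) ^ 2 + X (2, 1) * X (1, 1) ^ 2 + X (2, 0) * X (2, 2) ^ 2 +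
        C 2 * X (0, 1) * X (0, 0) * X (1, 1) + C 2 * X (0, 2) * X (0, 0) * X (2, 2) +
        C 2 * X (1, 2) * X (1, 1) * X (2, 2)) := by
  rw [aeval_pLambda]
  have hA : (1 / 2 : ℂ) • ((!![X (1, 0), X (0, 1) + X (2, 2), X (0, 2) - X (1, 1);
          X (0, 1) - X (2, 2), X (2, 1), X (1, 2) + X (0, 0);
          X (0, 2) + X (1, 1), X (1, 2) - X (0, 0), X (2, 0)] :
        Matrix (Fin 3) (Fin 3) (MvPolynomial (Fin 3 × Fin 3) ℂ)) -
      (!![X (1, 0), X (0, 1) + X (2, 2), X (0, 2) - X (1, 1);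
          X (0, 1) - X (2, 2), X (2, 1), X (1, 2) + X (0, 0);
          X (0, 2) + X (1, 1), X (1, 2) - X (0, 0), X (2, 0)] :
        Matrix (Fin 3) (Fin 3) (MvPolynomial (Fin 3 × Fin 3) ℂ))ᵀ) =
      !![0, X (2, 2), -X (1, 1); -X (2, 2), 0, X (0, 0); X (1, 1), -X (0, 0), 0] := by
    refine Matrix.ext fun i j => ?_
    fin_cases i <;> fin_cases j <;>
      simp only [Matrix.smul_apply, Matrix.sub_apply, Matrix.transpose_apply] <;> simp <;> module
  have hS : (1 / 2 : ℂ) • ((!![X (1, 0), X (0, 1) + X (2, 2), X (0, 2) - X (1, 1);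
          X (0, 1) - X (2, 2), X (2, 1), X (1, 2) + X (0, 0);
          X (0, 2) + X (1, 1), X (1, 2) - X (0, 0), X (2, 0)] :
        Matrix (Fin 3) (Fin 3) (MvPolynomial (Fin 3 × Fin 3) ℂ)) +
      (!![X (1, 0), X (0, 1) + X (2, 2), X (0, 2) - X (1, 1);
          X (0, 1) - X (2, 2), X (2, 1), X (1, 2) + X (0, 0);
          X (0, 2) + X (1, 1), X (1, 2) - X (0, 0), X (2, 0)] :
        Matrix (Fin 3) (Fin 3) (MvPolynomial (Fin 3 × Fin 3) ℂ))ᵀ) =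
      !![X (1, 0), X (0, 1), X (0, 2); X (0, 1), X (2, 1), X (1, 2); X (0, 2), X (1, 2), X (2, 0)] := by
    refine Matrix.ext fun i j => ?_
    fin_cases i <;> fin_cases j <;>
      simp only [Matrix.smul_apply, Matrix.add_apply, Matrix.transpose_apply] <;> simp <;> module
  rw [hA, hS, Matrix.adjugate_fin_three_of, Matrix.mul_fin_three, Matrix.trace_fin_three_of,
    MvPolynomial.smul_eq_C_mul]
  simp only [Nat.cast_ofNat, map_ofNat]
  ring

end Three


/-! ### The orbit tangent space of `Q = uᵀ S u` has dimension at least `64` -/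

section Rank

/-- The partial derivatives of `Q = uᵀ S u` in the six `S`-directions: `∂_{S_{ij}} Q = c_{ij} · u_i u_j`
(`c = 1` on the diagonal, `2` off it). [folklore] -/
private theorem pderiv_S_uSu (l : Fin 6) :
    pderiv ((![((1 : Fin 3), (0 : Fin 3)), (2, 1), (2, 0), (0, 1), (0, 2), (1, 2)] : Fin 6 → Fin 3 × Fin 3) l)
      (X (1, 0) * X (0, 0) ^ 2 + X (2, 1) * X (1, 1) ^ 2 + X (2, 0) * X (2, 2) ^ 2 +
        C 2 * X (0, 1) * X (0, 0) * X (1, 1) + C 2 * X (0, 2) * X (0, 0) * X (2, 2) +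
        C 2 * X (1, 2) * X (1, 1) * X (2, 2) : MvPolynomial (Fin 3 × Fin 3) ℂ) =
      ((![(1 : ℂ), 1, 1, 2, 2, 2] : Fin 6 → ℂ) l) •
        (![X (0, 0) * X (0, 0), X (1, 1) * X (1, 1), X (2, 2) * X (2, 2), X (0, 0) * X (1, 1),
          X (0, 0) * X (2, 2), X (1, 1) * X (2, 2)] : Fin 6 → MvPolynomial (Fin 3 × Fin 3) ℂ) l := by
  fin_cases l <;>
    simp [pderiv_X, Derivation.leibniz, Derivation.leibniz_pow, smul_eq_C_mul] <;>
    (try simp only [map_ofNat]) <;> ring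

/-- The partial derivatives of `Q = uᵀ S u` in the three `u`-directions: `∂_{u_l} Q = 2 (S u)_l`.
[folklore] -/
private theorem pderiv_u_uSu (l : Fin 3) :
    pderiv (l, l)
      (X (1, 0) * X (0, 0) ^ 2 + X (2, 1) * X (1, 1) ^ 2 + X (2, 0) * X (2, 2) ^ 2 +
        C 2 * X (0, 1) * X (0, 0) * X (1, 1) + C 2 * X (0, 2) * X (0, 0) * X (2, 2) +
        C 2 * X (1, 2) * X (1, 1) * X (2, 2) : MvPolynomial (Fin 3 × Fin 3) ℂ) =
      (2 : ℂ) • ∑ j : Fin 3, (!![X (1, 0), X (0, 1), X (0, 2); X (0, 1), X (2, 1), X (1, 2); X (0, 2), X (1, 2), X (2, 0)] :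
          Matrix (Fin 3) (Fin 3) (MvPolynomial (Fin 3 × Fin 3) ℂ)) l j * X (j, j) := by
  fin_cases l <;>
    simp [pderiv_X, Derivation.leibniz, Derivation.leibniz_pow, smul_eq_C_mul, Fin.sum_univ_three] <;>
    (try simp only [map_ofNat]) <;> ring

/-- Blocks I–II membership: every `x_b · u_i u_j` lies in `𝔤𝔩(W)·Q` (it is `c⁻¹ · x_b ∂_{S_{ij}} Q`).
[folklore] -/
private theorem X_mul_uQuad_mem_glTangent_uSu (b : Fin 3 × Fin 3) (l : Fin 6) :
    X b * (![X (0, 0) * X (0, 0), X (1, 1) * X (1, 1), X (2, 2) * X (2, 2), X (0, 0) * X (1, 1),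
          X (0, 0) * X (2, 2), X (1, 1) * X (2, 2)] : Fin 6 → MvPolynomial (Fin 3 × Fin 3) ℂ) l ∈
      glTangent (X (1, 0) * X (0, 0) ^ 2 + X (2, 1) * X (1, 1) ^ 2 + X (2, 0) * X (2, 2) ^ 2 +
        C 2 * X (0, 1) * X (0, 0) * X (1, 1) + C 2 * X (0, 2) * X (0, 0) * X (2, 2) +
        C 2 * X (1, 2) * X (1, 1) * X (2, 2) : MvPolynomial (Fin 3 × Fin 3) ℂ) := by
  have hc : ((![(1 : ℂ), 1, 1, 2, 2, 2] : Fin 6 → ℂ) l) ≠ 0 := by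
    fin_cases l <;> simp
  have h := Submodule.smul_mem _ (((![(1 : ℂ), 1, 1, 2, 2, 2] : Fin 6 → ℂ) l)⁻¹)
    (X_mul_pderiv_mem_glTangent
      (X (1, 0) * X (0, 0) ^ 2 + X (2, 1) * X (1, 1) ^ 2 + X (2, 0) * X (2, 2) ^ 2 +
        C 2 * X (0, 1) * X (0, 0) * X (1, 1) + C 2 * X (0, 2) * X (0, 0) * X (2, 2) +
        C 2 * X (1, 2) * X (1, 1) * X (2, 2) : MvPolynomial (Fin 3 × Fin 3) ℂ)
      ((![((1 : Fin 3), (0 : Fin 3)), (2, 1), (2, 0), (0, 1), (0, 2), (1, 2)] : Fin 6 → Fin 3 × Fin 3) l) b)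
  rw [pderiv_S_uSu, mul_smul_comm, smul_smul, inv_mul_cancel₀ hc, one_smul] at h
  exact h

/-- Block III membership: every `x_b · (S u)_l` lies in `𝔤𝔩(W)·Q` (it is `½ · x_b ∂_{u_l} Q`).
[folklore] -/
private theorem X_mul_Su_mem_glTangent_uSu (b : Fin 3 × Fin 3) (l : Fin 3) :
    X b * ∑ j : Fin 3, (!![X (1, 0), X (0, 1), X (0, 2); X (0, 1), X (2, 1), X (1, 2); X (0, 2), X (1, 2), X (2, 0)] :
          Matrix (Fin 3) (Fin 3) (MvPolynomial (Fin 3 × Fin 3) ℂ)) l j * X (j, j) ∈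
      glTangent (X (1, 0) * X (0, 0) ^ 2 + X (2, 1) * X (1, 1) ^ 2 + X (2, 0) * X (2, 2) ^ 2 +
        C 2 * X (0, 1) * X (0, 0) * X (1, 1) + C 2 * X (0, 2) * X (0, 0) * X (2, 2) +
        C 2 * X (1, 2) * X (1, 1) * X (2, 2) : MvPolynomial (Fin 3 × Fin 3) ℂ) := by
  have h := Submodule.smul_mem _ ((2 : ℂ)⁻¹)
    (X_mul_pderiv_mem_glTangent
      (X (1, 0) * X (0, 0) ^ 2 + X (2, 1) * X (1, 1) ^ 2 + X (2, 0) * X (2, 2) ^ 2 +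
        C 2 * X (0, 1) * X (0, 0) * X (1, 1) + C 2 * X (0, 2) * X (0, 0) * X (2, 2) +
        C 2 * X (1, 2) * X (1, 1) * X (2, 2) : MvPolynomial (Fin 3 × Fin 3) ℂ)
      (l, l) b)
  rw [pderiv_u_uSu, mul_smul_comm, smul_smul, inv_mul_cancel₀ (two_ne_zero' ℂ), one_smul] at h
  exact h

/-- The six quadratic monomials in `u` are linearly independent (detected by second partial
derivatives at the origin). [folklore] -/
private theorem linearIndependent_uQuad :
    LinearIndependent ℂ (![X (0, 0) * X (0, 0), X (1, 1) * X (1, 1), X (2, 2) * X (2, 2), X (0, 0) * X (1, 1),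
          X (0, 0) * X (2, 2), X (1, 1) * X (2, 2)] : Fin 6 → MvPolynomial (Fin 3 × Fin 3) ℂ) := by
  rw [Fintype.linearIndependent_iff]
  intro g hg i
  have D := fun a b : Fin 3 × Fin 3 =>
    congr_arg (fun p : MvPolynomial (Fin 3 × Fin 3) ℂ => coeff 0 (pderiv a (pderiv b p))) hg
  fin_cases i
  · have h := D (0, 0) (0, 0)
    simp [Fin.sum_univ_succ, pderiv_X, Derivation.leibniz] at h
    try ring_nf at h
    simpa using h
  · have h := D (1, 1) (1, 1)
    simp [Fin.sum_univ_succ, pderiv_X, Derivation.leibniz] at h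
    try ring_nf at h
    simpa using h
  · have h := D (2, 2) (2, 2)
    simp [Fin.sum_univ_succ, pderiv_X, Derivation.leibniz] at h
    try ring_nf at h
    simpa using h
  · have h := D (0, 0) (1, 1)
    simp [Fin.sum_univ_succ, pderiv_X, Derivation.leibniz] at h
    try ring_nf at h
    simpa using h
  · have h := D (0, 0) (2, 2)
    simp [Fin.sum_univ_succ, pderiv_X, Derivation.leibniz] at h
    try ring_nf at h
    simpa using h
  · have h := D (1, 1) (2, 2)
    simp [Fin.sum_univ_succ, pderiv_X, Derivation.leibniz] at h
    try ring_nf at h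
    simpa using h

/-- An off-diagonal partial derivative kills the quadratic `u`-monomials. [folklore] -/
private theorem pderiv_offDiag_uQuad (k : {p : Fin 3 × Fin 3 // p.1 ≠ p.2}) (l : Fin 6) :
    pderiv (k : Fin 3 × Fin 3) ((![X (0, 0) * X (0, 0), X (1, 1) * X (1, 1), X (2, 2) * X (2, 2), X (0, 0) * X (1, 1),
          X (0, 0) * X (2, 2), X (1, 1) * X (2, 2)] : Fin 6 → MvPolynomial (Fin 3 × Fin 3) ℂ) l) = 0 := by
  have hne : ∀ i : Fin 3, ((i, i) : Fin 3 × Fin 3) ≠ (k : Fin 3 × Fin 3) := by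
    intro i h
    exact k.2 (by rw [← h])
  fin_cases l <;> simp [pderiv_X, Derivation.leibniz, hne]

/-- **Block I** (36 elements): the products `S_k · u_i u_j` (`S_k` an off-diagonal variable) are
linearly independent: differentiating in `S_k` isolates the `k`-row, then `linearIndependent_uQuad`.
[folklore] -/
private theorem linearIndependent_blockI :
    LinearIndependent ℂ (fun kl : {p : Fin 3 × Fin 3 // p.1 ≠ p.2} × Fin 6 =>
      X (kl.1 : Fin 3 × Fin 3) * (![X (0, 0) * X (0, 0), X (1, 1) * X (1, 1), X (2, 2) * X (2, 2), X (0, 0) * X (1, 1),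
          X (0, 0) * X (2, 2), X (1, 1) * X (2, 2)] : Fin 6 → MvPolynomial (Fin 3 × Fin 3) ℂ) kl.2) := by
  rw [Fintype.linearIndependent_iff]
  rintro g hg ⟨k, l⟩
  have h := congr_arg (pderiv (k : Fin 3 × Fin 3)) hg
  rw [map_sum, map_zero, Fintype.sum_prod_type] at h
  have hrow : ∑ l' : Fin 6, g (k, l') • (![X (0, 0) * X (0, 0), X (1, 1) * X (1, 1), X (2, 2) * X (2, 2), X (0, 0) * X (1, 1),
          X (0, 0) * X (2, 2), X (1, 1) * X (2, 2)] : Fin 6 → MvPolynomial (Fin 3 × Fin 3) ℂ) l' = 0 := by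
    rw [← h]
    symm
    rw [Finset.sum_eq_single k]
    · refine Finset.sum_congr rfl fun l' _ => ?_
      simp [Derivation.leibniz, pderiv_offDiag_uQuad, pderiv_X]
    · intro k' _ hk'
      have hne : ((k' : Fin 3 × Fin 3)) ≠ (k : Fin 3 × Fin 3) := fun h => hk' (Subtype.ext h)
      refine Finset.sum_eq_zero fun l' _ => ?_
      simp [Derivation.leibniz, pderiv_offDiag_uQuad, pderiv_X, Pi.single_eq_of_ne hne]
    · intro hk; exact absurd (Finset.mem_univ k) hk
  exact (Fintype.linearIndependent_iff.mp linearIndependent_uQuad (fun l' => g (k, l')) hrow) l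

/-- **Block II** (10 elements): the cubic monomials in `u` are linearly independent (detected by third
partial derivatives at the origin). [folklore] -/
private theorem linearIndependent_blockII :
    LinearIndependent ℂ (![X (0, 0) * (X (0, 0) * X (0, 0)), X (1, 1) * (X (1, 1) * X (1, 1)), X (2, 2) * (X (2, 2) * X (2, 2)),
          X (1, 1) * (X (0, 0) * X (0, 0)), X (2, 2) * (X (0, 0) * X (0, 0)), X (0, 0) * (X (1, 1) * X (1, 1)),
          X (2, 2) * (X (1, 1) * X (1, 1)), X (0, 0) * (X (2, 2) * X (2, 2)), X (1, 1) * (X (2, 2) * X (2, 2)),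
          X (0, 0) * (X (1, 1) * X (2, 2))] : Fin 10 → MvPolynomial (Fin 3 × Fin 3) ℂ) := by
  rw [Fintype.linearIndependent_iff]
  intro g hg i
  have D := fun a b c : Fin 3 × Fin 3 =>
    congr_arg (fun p : MvPolynomial (Fin 3 × Fin 3) ℂ => coeff 0 (pderiv a (pderiv b (pderiv c p)))) hg
  fin_cases i
  · have h := D (0, 0) (0, 0) (0, 0)
    simp [Fin.sum_univ_succ, pderiv_X, Derivation.leibniz] at h
    try ring_nf at h
    simpa using h
  · have h := D (1, 1) (1, 1) (1, 1)
    simp [Fin.sum_univ_succ, pderiv_X, Derivation.leibniz] at h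
    try ring_nf at h
    simpa using h
  · have h := D (2, 2) (2, 2) (2, 2)
    simp [Fin.sum_univ_succ, pderiv_X, Derivation.leibniz] at h
    try ring_nf at h
    simpa using h
  · have h := D (1, 1) (0, 0) (0, 0)
    simp [Fin.sum_univ_succ, pderiv_X, Derivation.leibniz] at h
    try ring_nf at h
    simpa using h
  · have h := D (2, 2) (0, 0) (0, 0)
    simp [Fin.sum_univ_succ, pderiv_X, Derivation.leibniz] at h
    try ring_nf at h
    simpa using h
  · have h := D (0, 0) (1, 1) (1, 1)
    simp [Fin.sum_univ_succ, pderiv_X, Derivation.leibniz] at h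
    try ring_nf at h
    simpa using h
  · have h := D (2, 2) (1, 1) (1, 1)
    simp [Fin.sum_univ_succ, pderiv_X, Derivation.leibniz] at h
    try ring_nf at h
    simpa using h
  · have h := D (0, 0) (2, 2) (2, 2)
    simp [Fin.sum_univ_succ, pderiv_X, Derivation.leibniz] at h
    try ring_nf at h
    simpa using h
  · have h := D (1, 1) (2, 2) (2, 2)
    simp [Fin.sum_univ_succ, pderiv_X, Derivation.leibniz] at h
    try ring_nf at h
    simpa using h
  · have h := D (0, 0) (1, 1) (2, 2)
    simp [Fin.sum_univ_succ, pderiv_X, Derivation.leibniz] at h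
    try ring_nf at h
    simpa using h

/-- The generic symmetric `3 × 3` matrix `𝕊` of the `S`-variables has nonzero determinant (it
specialises to the identity matrix). [folklore] -/
private theorem det_symS_ne_zero :
    ((!![X (1, 0), X (0, 1), X (0, 2); X (0, 1), X (2, 1), X (1, 2); X (0, 2), X (1, 2), X (2, 0)] :
          Matrix (Fin 3) (Fin 3) (MvPolynomial (Fin 3 × Fin 3) ℂ))).det ≠ 0 := by
  intro h
  have h1 := congr_arg (eval fun p : Fin 3 × Fin 3 =>
    if p = (1, 0) ∨ p = (2, 1) ∨ p = (2, 0) then (1 : ℂ) else 0) h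
  rw [RingHom.map_det, map_zero] at h1
  apply one_ne_zero (α := ℂ)
  rw [← h1, Matrix.det_fin_three]
  simp [RingHom.mapMatrix_apply]

/-- A diagonal partial derivative kills the entries of `𝕊`. [folklore] -/
private theorem pderiv_diag_symS (j l j' : Fin 3) :
    pderiv (j, j) ((!![X (1, 0), X (0, 1), X (0, 2); X (0, 1), X (2, 1), X (1, 2); X (0, 2), X (1, 2), X (2, 0)] :
          Matrix (Fin 3) (Fin 3) (MvPolynomial (Fin 3 × Fin 3) ℂ)) l j') = 0 := by
  fin_cases j <;> fin_cases l <;> fin_cases j' <;> simp [pderiv_X]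

/-- **Block III** (18 elements): the products `S_k · (S u)_l` are linearly independent. Applying
`∂/∂u_j` to a relation gives `Σ_l ℓ_l S_{lj} = 0` with `ℓ_l` linear in the `S`-variables, i.e.
`ℓ · 𝕊 = 0`, whence `det 𝕊 · ℓ = 0` (adjugate) and `ℓ = 0`. [folklore] -/
private theorem linearIndependent_blockIII :
    LinearIndependent ℂ (fun kl : {p : Fin 3 × Fin 3 // p.1 ≠ p.2} × Fin 3 =>
      X (kl.1 : Fin 3 × Fin 3) * ∑ j : Fin 3, (!![X (1, 0), X (0, 1), X (0, 2); X (0, 1), X (2, 1), X (1, 2); X (0, 2), X (1, 2), X (2, 0)] :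
          Matrix (Fin 3) (Fin 3) (MvPolynomial (Fin 3 × Fin 3) ℂ)) kl.2 j * X (j, j)) := by
  classical
  rw [Fintype.linearIndependent_iff]
  intro g hg
  have hdet := det_symS_ne_zero
  have hdS := pderiv_diag_symS
  generalize hSS : (!![X (1, 0), X (0, 1), X (0, 2); X (0, 1), X (2, 1), X (1, 2); X (0, 2), X (1, 2), X (2, 0)] :
          Matrix (Fin 3) (Fin 3) (MvPolynomial (Fin 3 × Fin 3) ℂ)) = SS at hg hdet hdS
  set ℓ : Fin 3 → MvPolynomial (Fin 3 × Fin 3) ℂ :=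
    fun l' => ∑ k' : {p : Fin 3 × Fin 3 // p.1 ≠ p.2}, g (k', l') • X (k' : Fin 3 × Fin 3) with hℓ
  -- `∂/∂u_j` of the relation: `(ℓ ᵥ* 𝕊)_j = 0`
  have hq : ∀ j : Fin 3, (ℓ ᵥ* SS) j = 0 := by
    intro j
    have h := congr_arg (pderiv (j, j)) hg
    rw [map_sum, map_zero] at h
    have hterm : ∀ kl : {p : Fin 3 × Fin 3 // p.1 ≠ p.2} × Fin 3,
        pderiv (j, j) (g kl • (X (kl.1 : Fin 3 × Fin 3) * ∑ j' : Fin 3, SS kl.2 j' * X (j', j'))) =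
          g kl • (X (kl.1 : Fin 3 × Fin 3) * SS kl.2 j) := by
      intro kl
      have hk : pderiv (j, j) (X (kl.1 : Fin 3 × Fin 3) : MvPolynomial (Fin 3 × Fin 3) ℂ) = 0 := by
        rw [pderiv_X, Pi.single_eq_of_ne]
        intro h'
        exact kl.1.2 (by rw [h'])
      rw [Derivation.map_smul, Derivation.leibniz, hk, smul_zero, add_zero, map_sum, smul_eq_mul]
      congr 1
      rw [Finset.sum_eq_single j]
      · rw [Derivation.leibniz, hdS, smul_zero, add_zero, pderiv_X, Pi.single_eq_same, smul_eq_mul,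
          mul_one]
      · intro j' _ hj'
        rw [Derivation.leibniz, hdS, pderiv_X,
          Pi.single_eq_of_ne (fun h' => hj' (Prod.mk.inj h').1), smul_zero, smul_zero, add_zero]
      · intro hj; exact absurd (Finset.mem_univ j) hj
    simp only [hterm] at h
    have hre : (ℓ ᵥ* SS) j = ∑ kl : {p : Fin 3 × Fin 3 // p.1 ≠ p.2} × Fin 3,
        g kl • (X (kl.1 : Fin 3 × Fin 3) * SS kl.2 j) := by
      simp only [Matrix.vecMul, dotProduct, hℓ, Finset.sum_mul, smul_mul_assoc]
      rw [Fintype.sum_prod_type_right]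
    rw [hre]
    exact h
  have hzero : ℓ ᵥ* SS = 0 := funext hq
  -- `det 𝕊 · ℓ = 0`, hence `ℓ = 0`
  have hℓ0 : ∀ l, ℓ l = 0 := by
    intro l
    have h := congr_arg (fun v => Matrix.vecMul v SS.adjugate) hzero
    simp only [Matrix.vecMul_vecMul, Matrix.mul_adjugate, Matrix.vecMul_smul, Matrix.vecMul_one,
      Matrix.zero_vecMul] at h
    have h' := congr_fun h l
    rw [Pi.smul_apply, Pi.zero_apply, smul_eq_mul] at h'
    exact (mul_eq_zero.mp h').resolve_left hdet
  -- the variables `S_k` are linearly independent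
  have hX : LinearIndependent ℂ (fun k' : {p : Fin 3 × Fin 3 // p.1 ≠ p.2} =>
      (X (k' : Fin 3 × Fin 3) : MvPolynomial (Fin 3 × Fin 3) ℂ)) :=
    (linearIndependent_X (Fin 3 × Fin 3) ℂ).comp _ Subtype.val_injective
  rintro ⟨k, l⟩
  exact (Fintype.linearIndependent_iff.mp hX (fun k' => g (k', l)) (hℓ0 l)) k

/-- Weighted-homogeneous pieces of distinct weights meet trivially, also against a sum of two other
pieces. [folklore] -/
private theorem disjoint_weightedHomogeneousSubmodule_sup {σ : Type*} (w : σ → ℕ) {m n₁ n₂ : ℕ} (h₁ : m ≠ n₁)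
    (h₂ : m ≠ n₂) :
    Disjoint (weightedHomogeneousSubmodule ℂ w m)
      (weightedHomogeneousSubmodule ℂ w n₁ ⊔ weightedHomogeneousSubmodule ℂ w n₂) := by
  classical
  rw [Submodule.disjoint_def]
  intro x hx hx'
  obtain ⟨y, hy, z, hz, rfl⟩ := Submodule.mem_sup.mp hx'
  have ey := weightedHomogeneousComponent_of_mem (w := w) (m := m) hy
  have ez := weightedHomogeneousComponent_of_mem (w := w) (m := m) hz
  have ex := weightedHomogeneousComponent_of_mem (w := w) (m := m) hx
  rw [if_neg h₁] at ey
  rw [if_neg h₂] at ez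
  rw [if_pos rfl, map_add, ey, ez, add_zero] at ex
  exact ex.symm

end Rank

/-! ### Assembly: `dim 𝔤𝔩(W)·Q ≥ 64`, hence `dim 𝔤𝔩(W)_{P_{Λ,3}} ≤ 17` -/

section Assembly

/-- Block II elements have `u`-weight `3`. [folklore] -/
private theorem blockII_mem_weightedHomogeneousSubmodule (t : Fin 10) :
    (![X (0, 0) * (X (0, 0) * X (0, 0)), X (1, 1) * (X (1, 1) * X (1, 1)), X (2, 2) * (X (2, 2) * X (2, 2)),
          X (1, 1) * (X (0, 0) * X (0, 0)), X (2, 2) * (X (0, 0) * X (0, 0)), X (0, 0) * (X (1, 1) * X (1, 1)),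
          X (2, 2) * (X (1, 1) * X (1, 1)), X (0, 0) * (X (2, 2) * X (2, 2)), X (1, 1) * (X (2, 2) * X (2, 2)),
          X (0, 0) * (X (1, 1) * X (2, 2))] : Fin 10 → MvPolynomial (Fin 3 × Fin 3) ℂ) t ∈ weightedHomogeneousSubmodule ℂ (fun p : Fin 3 × Fin 3 => if p.1 = p.2 then 1 else 0) 3 := by
  have hu : ∀ i : Fin 3, IsWeightedHomogeneous (fun p : Fin 3 × Fin 3 => if p.1 = p.2 then 1 else 0)
      (X (i, i) : MvPolynomial (Fin 3 × Fin 3) ℂ) 1 := by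
    intro i
    simpa using isWeightedHomogeneous_X ℂ (fun p : Fin 3 × Fin 3 => if p.1 = p.2 then 1 else 0) (i, i)
  have h3 : ∀ i j k : Fin 3, IsWeightedHomogeneous (fun p : Fin 3 × Fin 3 => if p.1 = p.2 then 1 else 0)
      (X (i, i) * (X (j, j) * X (k, k)) : MvPolynomial (Fin 3 × Fin 3) ℂ) 3 := by
    intro i j k
    have h := (hu i).mul ((hu j).mul (hu k))
    exact h
  fin_cases t <;> exact h3 _ _ _

/-- Block I elements have `u`-weight `2`. [folklore] -/
private theorem blockI_mem_weightedHomogeneousSubmodule (k : {p : Fin 3 × Fin 3 // p.1 ≠ p.2}) (l : Fin 6) :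
    X (k : Fin 3 × Fin 3) * (![X (0, 0) * X (0, 0), X (1, 1) * X (1, 1), X (2, 2) * X (2, 2), X (0, 0) * X (1, 1),
          X (0, 0) * X (2, 2), X (1, 1) * X (2, 2)] : Fin 6 → MvPolynomial (Fin 3 × Fin 3) ℂ) l ∈ weightedHomogeneousSubmodule ℂ (fun p : Fin 3 × Fin 3 => if p.1 = p.2 then 1 else 0) 2 := by
  have hu : ∀ i : Fin 3, IsWeightedHomogeneous (fun p : Fin 3 × Fin 3 => if p.1 = p.2 then 1 else 0)
      (X (i, i) : MvPolynomial (Fin 3 × Fin 3) ℂ) 1 := by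
    intro i
    simpa using isWeightedHomogeneous_X ℂ (fun p : Fin 3 × Fin 3 => if p.1 = p.2 then 1 else 0) (i, i)
  have hk : IsWeightedHomogeneous (fun p : Fin 3 × Fin 3 => if p.1 = p.2 then 1 else 0)
      (X (k : Fin 3 × Fin 3) : MvPolynomial (Fin 3 × Fin 3) ℂ) 0 := by
    have h := isWeightedHomogeneous_X ℂ (fun p : Fin 3 × Fin 3 => if p.1 = p.2 then 1 else 0) (k : Fin 3 × Fin 3)
    simp only [if_neg k.2] at h
    exact h
  have h2 : ∀ i j : Fin 3, IsWeightedHomogeneous (fun p : Fin 3 × Fin 3 => if p.1 = p.2 then 1 else 0)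
      (X (k : Fin 3 × Fin 3) * (X (i, i) * X (j, j)) : MvPolynomial (Fin 3 × Fin 3) ℂ) 2 := by
    intro i j
    have h := hk.mul ((hu i).mul (hu j))
    exact h
  fin_cases l <;> exact h2 _ _

/-- Block III elements have `u`-weight `1`. [folklore] -/
private theorem blockIII_mem_weightedHomogeneousSubmodule (k : {p : Fin 3 × Fin 3 // p.1 ≠ p.2}) (l : Fin 3) :
    X (k : Fin 3 × Fin 3) * ∑ j : Fin 3, (!![X (1, 0), X (0, 1), X (0, 2); X (0, 1), X (2, 1), X (1, 2); X (0, 2), X (1, 2), X (2, 0)] :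
          Matrix (Fin 3) (Fin 3) (MvPolynomial (Fin 3 × Fin 3) ℂ)) l j * X (j, j) ∈
      weightedHomogeneousSubmodule ℂ (fun p : Fin 3 × Fin 3 => if p.1 = p.2 then 1 else 0) 1 := by
  have hu : ∀ i : Fin 3, IsWeightedHomogeneous (fun p : Fin 3 × Fin 3 => if p.1 = p.2 then 1 else 0)
      (X (i, i) : MvPolynomial (Fin 3 × Fin 3) ℂ) 1 := by
    intro i
    simpa using isWeightedHomogeneous_X ℂ (fun p : Fin 3 × Fin 3 => if p.1 = p.2 then 1 else 0) (i, i)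
  have hoff : ∀ p : Fin 3 × Fin 3, p.1 ≠ p.2 → IsWeightedHomogeneous (fun p : Fin 3 × Fin 3 => if p.1 = p.2 then 1 else 0)
      (X p : MvPolynomial (Fin 3 × Fin 3) ℂ) 0 := by
    intro p hp
    have h := isWeightedHomogeneous_X ℂ (fun p : Fin 3 × Fin 3 => if p.1 = p.2 then 1 else 0) p
    simp only [if_neg hp] at h
    exact h
  have hS : ∀ l j : Fin 3, IsWeightedHomogeneous (fun p : Fin 3 × Fin 3 => if p.1 = p.2 then 1 else 0) ((!![X (1, 0), X (0, 1), X (0, 2); X (0, 1), X (2, 1), X (1, 2); X (0, 2), X (1, 2), X (2, 0)] :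
          Matrix (Fin 3) (Fin 3) (MvPolynomial (Fin 3 × Fin 3) ℂ)) l j) 0 := by
    intro l j
    fin_cases l <;> fin_cases j <;> exact hoff _ (by decide)
  have hsum : IsWeightedHomogeneous (fun p : Fin 3 × Fin 3 => if p.1 = p.2 then 1 else 0)
      (∑ j : Fin 3, (!![X (1, 0), X (0, 1), X (0, 2); X (0, 1), X (2, 1), X (1, 2); X (0, 2), X (1, 2), X (2, 0)] :
          Matrix (Fin 3) (Fin 3) (MvPolynomial (Fin 3 × Fin 3) ℂ)) l j * X (j, j)) 1 := by
    refine (weightedHomogeneousSubmodule ℂ (fun p : Fin 3 × Fin 3 => if p.1 = p.2 then 1 else 0) 1).sum_mem fun j _ => ?_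
    have h := (hS l j).mul (hu j)
    exact h
  have h := (hoff k k.2).mul hsum
  exact h

/-- **`dim 𝔤𝔩(W)·Q ≥ 64`** for `Q = uᵀ S u`: the `36 + 10 + 18` elements of blocks I, II, III lie in
`𝔤𝔩(W)·Q`, are linearly independent within each block, and the blocks sit in distinct `u`-weights
(the `n = 3` instance of the stabiliser count of LMR 2013 §3.5 in adapted coordinates).
[cite: LandsbergManivelRessayre2013, §3.5 (p. 481)] -/
theorem le_finrank_glTangent_uSu :
    64 ≤ Module.finrank ℂ (glTangent (X (1, 0) * X (0, 0) ^ 2 + X (2, 1) * X (1, 1) ^ 2 + X (2, 0) * X (2, 2) ^ 2 +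
        C 2 * X (0, 1) * X (0, 0) * X (1, 1) + C 2 * X (0, 2) * X (0, 0) * X (2, 2) +
        C 2 * X (1, 2) * X (1, 1) * X (2, 2) : MvPolynomial (Fin 3 × Fin 3) ℂ)) := by
  classical
  set Q : MvPolynomial (Fin 3 × Fin 3) ℂ := (X (1, 0) * X (0, 0) ^ 2 + X (2, 1) * X (1, 1) ^ 2 + X (2, 0) * X (2, 2) ^ 2 +
        C 2 * X (0, 1) * X (0, 0) * X (1, 1) + C 2 * X (0, 2) * X (0, 0) * X (2, 2) +
        C 2 * X (1, 2) * X (1, 1) * X (2, 2) : MvPolynomial (Fin 3 × Fin 3) ℂ) with hQ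
  haveI := glTangent_finiteDimensional Q
  -- the three families
  set v₁ : {p : Fin 3 × Fin 3 // p.1 ≠ p.2} × Fin 6 → MvPolynomial (Fin 3 × Fin 3) ℂ := fun kl =>
    X (kl.1 : Fin 3 × Fin 3) * (![X (0, 0) * X (0, 0), X (1, 1) * X (1, 1), X (2, 2) * X (2, 2), X (0, 0) * X (1, 1),
          X (0, 0) * X (2, 2), X (1, 1) * X (2, 2)] : Fin 6 → MvPolynomial (Fin 3 × Fin 3) ℂ) kl.2 with hv₁
  set v₂ : Fin 10 → MvPolynomial (Fin 3 × Fin 3) ℂ := (![X (0, 0) * (X (0, 0) * X (0, 0)), X (1, 1) * (X (1, 1) * X (1, 1)), X (2, 2) * (X (2, 2) * X (2, 2)),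
          X (1, 1) * (X (0, 0) * X (0, 0)), X (2, 2) * (X (0, 0) * X (0, 0)), X (0, 0) * (X (1, 1) * X (1, 1)),
          X (2, 2) * (X (1, 1) * X (1, 1)), X (0, 0) * (X (2, 2) * X (2, 2)), X (1, 1) * (X (2, 2) * X (2, 2)),
          X (0, 0) * (X (1, 1) * X (2, 2))] : Fin 10 → MvPolynomial (Fin 3 × Fin 3) ℂ) with hv₂
  set v₃ : {p : Fin 3 × Fin 3 // p.1 ≠ p.2} × Fin 3 → MvPolynomial (Fin 3 × Fin 3) ℂ := fun kl =>
    X (kl.1 : Fin 3 × Fin 3) * ∑ j : Fin 3, (!![X (1, 0), X (0, 1), X (0, 2); X (0, 1), X (2, 1), X (1, 2); X (0, 2), X (1, 2), X (2, 0)] :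
          Matrix (Fin 3) (Fin 3) (MvPolynomial (Fin 3 × Fin 3) ℂ)) kl.2 j * X (j, j) with hv₃
  have i₁ : LinearIndependent ℂ v₁ := linearIndependent_blockI
  have i₂ : LinearIndependent ℂ v₂ := linearIndependent_blockII
  have i₃ : LinearIndependent ℂ v₃ := linearIndependent_blockIII
  -- spans in the weighted pieces
  have s₁ : Submodule.span ℂ (Set.range v₁) ≤ weightedHomogeneousSubmodule ℂ (fun p : Fin 3 × Fin 3 => if p.1 = p.2 then 1 else 0) 2 := by
    rw [Submodule.span_le]; rintro _ ⟨⟨k, l⟩, rfl⟩; exact blockI_mem_weightedHomogeneousSubmodule k l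
  have s₂ : Submodule.span ℂ (Set.range v₂) ≤ weightedHomogeneousSubmodule ℂ (fun p : Fin 3 × Fin 3 => if p.1 = p.2 then 1 else 0) 3 := by
    rw [Submodule.span_le]; rintro _ ⟨t, rfl⟩; exact blockII_mem_weightedHomogeneousSubmodule t
  have s₃ : Submodule.span ℂ (Set.range v₃) ≤ weightedHomogeneousSubmodule ℂ (fun p : Fin 3 × Fin 3 => if p.1 = p.2 then 1 else 0) 1 := by
    rw [Submodule.span_le]; rintro _ ⟨⟨k, l⟩, rfl⟩; exact blockIII_mem_weightedHomogeneousSubmodule k l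
  have i₁₃ : LinearIndependent ℂ (Sum.elim v₁ v₃) := by
    refine i₁.sum_type i₃ ?_
    refine (disjoint_weightedHomogeneousSubmodule_sup (fun p : Fin 3 × Fin 3 => if p.1 = p.2 then 1 else 0) (m := 2) (n₁ := 1) (n₂ := 1)
      (by decide) (by decide)).mono s₁ ?_
    exact s₃.trans le_sup_left
  have i : LinearIndependent ℂ (Sum.elim v₂ (Sum.elim v₁ v₃)) := by
    refine i₂.sum_type i₁₃ ?_
    refine (disjoint_weightedHomogeneousSubmodule_sup (fun p : Fin 3 × Fin 3 => if p.1 = p.2 then 1 else 0) (m := 3) (n₁ := 2) (n₂ := 1)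
      (by decide) (by decide)).mono s₂ ?_
    rw [Set.Sum.elim_range, Submodule.span_union]
    exact sup_le_sup s₁ s₃
  -- all of them lie in `𝔤𝔩(W)·Q`
  have hmem : ∀ t, Sum.elim v₂ (Sum.elim v₁ v₃) t ∈ glTangent Q := by
    rintro (t | ⟨k, l⟩ | ⟨k, l⟩)
    · fin_cases t
      · exact X_mul_uQuad_mem_glTangent_uSu (0, 0) 0
      · exact X_mul_uQuad_mem_glTangent_uSu (1, 1) 1
      · exact X_mul_uQuad_mem_glTangent_uSu (2, 2) 2
      · exact X_mul_uQuad_mem_glTangent_uSu (1, 1) 0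
      · exact X_mul_uQuad_mem_glTangent_uSu (2, 2) 0
      · exact X_mul_uQuad_mem_glTangent_uSu (0, 0) 1
      · exact X_mul_uQuad_mem_glTangent_uSu (2, 2) 1
      · exact X_mul_uQuad_mem_glTangent_uSu (0, 0) 2
      · exact X_mul_uQuad_mem_glTangent_uSu (1, 1) 2
      · exact X_mul_uQuad_mem_glTangent_uSu (0, 0) 5
    · exact X_mul_uQuad_mem_glTangent_uSu k l
    · exact X_mul_Su_mem_glTangent_uSu k l
  have i' : LinearIndependent ℂ (fun t => (⟨_, hmem t⟩ : glTangent Q)) :=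
    LinearIndependent.of_comp (glTangent Q).subtype (by exact i)
  have hcard : Fintype.card (Fin 10 ⊕ ({p : Fin 3 × Fin 3 // p.1 ≠ p.2} × Fin 6 ⊕ {p : Fin 3 × Fin 3 // p.1 ≠ p.2} × Fin 3)) = 64 := by
    have h6 : Fintype.card {p : Fin 3 × Fin 3 // p.1 ≠ p.2} = 6 := by decide
    simp only [Fintype.card_sum, Fintype.card_prod, Fintype.card_fin, h6]
  rw [← hcard]
  exact i'.fintype_card_le_finrank

/-- The partial derivatives of the linear forms of the change of variables are constants.
[folklore] -/
private theorem pderiv_L_three (c a : Fin 3 × Fin 3) :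
    ∃ r : ℂ, pderiv a ((!![X (1, 0), X (0, 1) + X (2, 2), X (0, 2) - X (1, 1);
          X (0, 1) - X (2, 2), X (2, 1), X (1, 2) + X (0, 0);
          X (0, 2) + X (1, 1), X (1, 2) - X (0, 0), X (2, 0)] :
        Matrix (Fin 3) (Fin 3) (MvPolynomial (Fin 3 × Fin 3) ℂ)) c.1 c.2) = C r := by
  have hX : ∀ p : Fin 3 × Fin 3, ∃ r : ℂ, pderiv a (X p : MvPolynomial (Fin 3 × Fin 3) ℂ) = C r := by
    intro p
    by_cases h : p = a
    · subst h
      exact ⟨1, by rw [pderiv_X, Pi.single_eq_same, C_1]⟩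
    · exact ⟨0, by rw [pderiv_X, Pi.single_eq_of_ne h, C_0]⟩
  have hadd : ∀ p q : Fin 3 × Fin 3,
      ∃ r : ℂ, pderiv a (X p + X q : MvPolynomial (Fin 3 × Fin 3) ℂ) = C r := by
    intro p q
    obtain ⟨r₁, h₁⟩ := hX p
    obtain ⟨r₂, h₂⟩ := hX q
    exact ⟨r₁ + r₂, by rw [map_add, h₁, h₂, C_add]⟩
  have hsub : ∀ p q : Fin 3 × Fin 3,
      ∃ r : ℂ, pderiv a (X p - X q : MvPolynomial (Fin 3 × Fin 3) ℂ) = C r := by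
    intro p q
    obtain ⟨r₁, h₁⟩ := hX p
    obtain ⟨r₂, h₂⟩ := hX q
    exact ⟨r₁ - r₂, by rw [map_sub, h₁, h₂, C_sub]⟩
  obtain ⟨i, j⟩ := c
  fin_cases i <;> fin_cases j
  · exact hX (1, 0)
  · exact hadd (0, 1) (2, 2)
  · exact hsub (0, 2) (1, 1)
  · exact hsub (0, 1) (2, 2)
  · exact hX (2, 1)
  · exact hadd (1, 2) (0, 0)
  · exact hadd (0, 2) (1, 1)
  · exact hsub (1, 2) (0, 0)
  · exact hX (2, 0)

/-- The change of variables is invertible: every variable is the image of a linear form. [folklore] -/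
private theorem exists_aeval_L_three_eq_X (b : Fin 3 × Fin 3) :
    ∃ ℓ : MvPolynomial (Fin 3 × Fin 3) ℂ,
      ℓ ∈ Submodule.span ℂ (Set.range (X : Fin 3 × Fin 3 → MvPolynomial (Fin 3 × Fin 3) ℂ)) ∧
      aeval (fun p : Fin 3 × Fin 3 => (!![X (1, 0), X (0, 1) + X (2, 2), X (0, 2) - X (1, 1);
          X (0, 1) - X (2, 2), X (2, 1), X (1, 2) + X (0, 0);
          X (0, 2) + X (1, 1), X (1, 2) - X (0, 0), X (2, 0)] :
        Matrix (Fin 3) (Fin 3) (MvPolynomial (Fin 3 × Fin 3) ℂ)) p.1 p.2) ℓ = X b := by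
  have hXmem : ∀ p : Fin 3 × Fin 3, (X p : MvPolynomial (Fin 3 × Fin 3) ℂ) ∈
      Submodule.span ℂ (Set.range (X : Fin 3 × Fin 3 → MvPolynomial (Fin 3 × Fin 3) ℂ)) :=
    fun p => Submodule.subset_span ⟨p, rfl⟩
  have hhalf : ∀ p q : Fin 3 × Fin 3, (C (1 / 2 : ℂ) * (X p - X q) : MvPolynomial (Fin 3 × Fin 3) ℂ) ∈
      Submodule.span ℂ (Set.range (X : Fin 3 × Fin 3 → MvPolynomial (Fin 3 × Fin 3) ℂ)) := by
    intro p q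
    rw [← smul_eq_C_mul]
    exact Submodule.smul_mem _ _ (Submodule.sub_mem _ (hXmem p) (hXmem q))
  have hhalf' : ∀ p q : Fin 3 × Fin 3, (C (1 / 2 : ℂ) * (X p + X q) : MvPolynomial (Fin 3 × Fin 3) ℂ) ∈
      Submodule.span ℂ (Set.range (X : Fin 3 × Fin 3 → MvPolynomial (Fin 3 × Fin 3) ℂ)) := by
    intro p q
    rw [← smul_eq_C_mul]
    exact Submodule.smul_mem _ _ (Submodule.add_mem _ (hXmem p) (hXmem q))
  have key : (2 : MvPolynomial (Fin 3 × Fin 3) ℂ) * C ((2 : ℂ)⁻¹) = 1 := by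
    rw [← map_ofNat (C : ℂ →+* MvPolynomial (Fin 3 × Fin 3) ℂ) 2, ← map_mul, ← map_one C]
    congr 1
    norm_num
  obtain ⟨i, j⟩ := b
  fin_cases i <;> fin_cases j
  · refine ⟨C (1 / 2 : ℂ) * (X (1, 2) - X (2, 1)), hhalf _ _, ?_⟩
    simp only [map_mul, map_sub, aeval_X, algHom_C, algebraMap_eq]
    simp
    linear_combination (X (0, 0) : MvPolynomial (Fin 3 × Fin 3) ℂ) * key
  · refine ⟨C (1 / 2 : ℂ) * (X (0, 1) + X (1, 0)), hhalf' _ _, ?_⟩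
    simp only [map_mul, map_add, aeval_X, algHom_C, algebraMap_eq]
    simp
    linear_combination (X (0, 1) : MvPolynomial (Fin 3 × Fin 3) ℂ) * key
  · refine ⟨C (1 / 2 : ℂ) * (X (0, 2) + X (2, 0)), hhalf' _ _, ?_⟩
    simp only [map_mul, map_add, aeval_X, algHom_C, algebraMap_eq]
    simp
    linear_combination (X (0, 2) : MvPolynomial (Fin 3 × Fin 3) ℂ) * key
  · exact ⟨X (0, 0), hXmem _, by simp⟩
  · refine ⟨C (1 / 2 : ℂ) * (X (2, 0) - X (0, 2)), hhalf _ _, ?_⟩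
    simp only [map_mul, map_sub, aeval_X, algHom_C, algebraMap_eq]
    simp
    linear_combination (X (1, 1) : MvPolynomial (Fin 3 × Fin 3) ℂ) * key
  · refine ⟨C (1 / 2 : ℂ) * (X (1, 2) + X (2, 1)), hhalf' _ _, ?_⟩
    simp only [map_mul, map_add, aeval_X, algHom_C, algebraMap_eq]
    simp
    linear_combination (X (1, 2) : MvPolynomial (Fin 3 × Fin 3) ℂ) * key
  · exact ⟨X (2, 2), hXmem _, by simp⟩
  · exact ⟨X (1, 1), hXmem _, by simp⟩
  · refine ⟨C (1 / 2 : ℂ) * (X (0, 1) - X (1, 0)), hhalf _ _, ?_⟩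
    simp only [map_mul, map_sub, aeval_X, algHom_C, algebraMap_eq]
    simp
    linear_combination (X (2, 2) : MvPolynomial (Fin 3 × Fin 3) ℂ) * key

/-- **`dim 𝔤𝔩(W)·P_{Λ,3} ≥ 64`.** [cite: LandsbergManivelRessayre2013, Proposition 3.5.1 (p. 481)] -/
theorem le_finrank_glTangent_pLambda_three :
    64 ≤ Module.finrank ℂ (glTangent (pLambda 3)) := by
  have h1 := le_finrank_glTangent_uSu
  have h2 : glTangent (aeval (fun p : Fin 3 × Fin 3 => (!![X (1, 0), X (0, 1) + X (2, 2), X (0, 2) - X (1, 1);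
          X (0, 1) - X (2, 2), X (2, 1), X (1, 2) + X (0, 0);
          X (0, 2) + X (1, 1), X (1, 2) - X (0, 0), X (2, 0)] :
        Matrix (Fin 3) (Fin 3) (MvPolynomial (Fin 3 × Fin 3) ℂ)) p.1 p.2) (pLambda 3)) =
      glTangent (X (1, 0) * X (0, 0) ^ 2 + X (2, 1) * X (1, 1) ^ 2 + X (2, 0) * X (2, 2) ^ 2 +
        C 2 * X (0, 1) * X (0, 0) * X (1, 1) + C 2 * X (0, 2) * X (0, 0) * X (2, 2) +
        C 2 * X (1, 2) * X (1, 1) * X (2, 2) : MvPolynomial (Fin 3 × Fin 3) ℂ) := by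
    rw [aeval_pLambda_three_uSu, glTangent_C_mul (by norm_num)]
  rw [← h2] at h1
  exact h1.trans (finrank_glTangent_aeval_le _ pderiv_L_three exists_aeval_L_three_eq_X (pLambda 3))

/-- **LMR 2013, Prop. 3.5.1 at `n = 3`, the stabiliser count: `dim 𝔤𝔩(W)_{P_{Λ,3}} ≤ 17 = 2·3² − 1`**
("the Lie algebra of the stabilizer of `[P_Λ]` … has dimension `2n²`", arXiv `p0008.txt:L92`; affine
convention of the tree: the scalars are not in the annihilator, so `2n² − 1`). With
`finrank_glAnn_pLambda_ge` (`≥ 2n² − 1`, `LMR13StabilizerDimensions.lean`) the count is exact at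
`n = 3`. Hüttenhain–Lairez 2016, Lemma 2 (proof) obtain the same number for their `P₂ = uᵀ S u`
("dim H(P₂)", via "the nullspace of a `165 × 81` matrix, which is easy using a computer"); this is a
machine-free kernel certificate of that count. [cite: LandsbergManivelRessayre2013, Proposition 3.5.1 (p. 481)]
[cite: HuttenhainLairez2016, Lemma 2] -/
theorem finrank_glAnn_pLambda_three_le : Module.finrank ℂ (glAnn (pLambda 3)) ≤ 17 := by
  have h1 := finrank_glTangent_add_finrank_glAnn (pLambda 3)
  have h2 := le_finrank_glTangent_pLambda_three
  simp only [Fintype.card_prod, Fintype.card_fin] at h1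
  omega

/-- **`dim 𝔤𝔩(W)_{P_{Λ,3}} = 17 = 2·3² − 1` exactly** (with the tree's lower bound
`finrank_glAnn_pLambda_ge`): the printed "dimension `2n²`" of the stabiliser of `[P_Λ]`, affinely, at
`n = 3`; = `dim H(P₂) = 17` of Hüttenhain–Lairez 2016, Lemma 2 (`dim Ω(P₂) = 80 − dim H(P₂) = 63`).
[cite: LandsbergManivelRessayre2013, Proposition 3.5.1 (p. 481)] [cite: HuttenhainLairez2016, Lemma 2] -/
theorem finrank_glAnn_pLambda_three : Module.finrank ℂ (glAnn (pLambda 3)) = 17 :=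
  le_antisymm finrank_glAnn_pLambda_three_le (finrank_glAnn_pLambda_ge (n := 3) le_rfl)

/-- **The dimension of the orbit tangent space: `dim 𝔤𝔩(W)·P_{Λ,3} = 64`** (`= 81 − 17`; the affine
orbit dimension, one more than Hüttenhain–Lairez's projective `dim Ω(P₂) = 63`, Lemma 2).
[cite: LandsbergManivelRessayre2013, Proposition 3.5.1 (p. 481)] [cite: HuttenhainLairez2016, Lemma 2] -/
theorem finrank_glTangent_pLambda_three : Module.finrank ℂ (glTangent (pLambda 3)) = 64 := by
  have h1 := finrank_glTangent_add_finrank_glAnn (pLambda 3)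
  rw [finrank_glAnn_pLambda_three] at h1
  simp only [Fintype.card_prod, Fintype.card_fin] at h1
  omega

end Assembly

end Literature.Computability.AlgebraicComplexity
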